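import Summits.NavierStokesRegularity.NavierStokesRegularity.Theorems.ExtremiserTransienceNearExtremalTransienceExtremiserLiouvilleConstantSpeedEnergyFluxInvariance
import Summits.NavierStokesRegularity.NavierStokesRegularity.Theorems.ExtremiserTransienceNearExtremalTransienceExtremiserLiouvilleConstantSpeedDecayLiouvilleTools
import HarnessLib

/-!
# Crux `ExtremiserTransience.NearExtremalTransience` (stmt-NavierStokesRegularity-21883), line `extremiser_liouville`,
# stub K1b — ENERGY-FLUX LIOUVILLE THEOREMS (axial far field): vanishing windows; horizontal decay + far field

`--supports stmt-NavierStokesRegularity-21883` (helper).  Author: prover seat `ns-el-k1b` (g5).  Consequences of the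
energy-flux invariance `…ConstantSpeedEnergyFluxInvariance` (`E(s) = E(t)` for the window energies
`E(s) = ∫ H′(x₂ − s)‖w x − c‖² dx` of a constant-speed divergence-free field with far-field value `c = (0,0,c₂)`):

* `eq_zero_of_constSpeedDeviation_smallWindow_axial` / `eq_farField_of_constSpeed_of_smallWindow_axial` :
  **VANISHING-WINDOW LIOUVILLE** — `‖w − c‖² ∈ L¹` of every slab `{|x₂| ≤ T}` and `inf_s E(s) = 0` force `w ≡ c`
  (all windows carry the same energy, hence none; the windows cover `ℝ³`).  Contains g3's `L²` Liouville (`∫ E = ‖w − c‖₂²`)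
  and g4's decay-gap Liouville (`E(s) → 0`).  CONTRAPOSITIVE = THE JET ALTERNATIVE for the K1b residue object: if it is
  square integrable on slabs, every unit window of planes orthogonal to `c` carries the same excess energy `E₀ > 0`, far
  above and far below the core.
* `eq_zero_of_constSpeedDeviation_horizontalDecay_axial` / `eq_farField_of_constSpeed_of_horizontalDecay_axial` :
  **HORIZONTAL-DECAY LIOUVILLE** — `w → c` at infinity and `‖w x − c‖ ≤ C₀(1 + dist(x, axis))^{-a}`, `a > 1` (decay in the
  distance to the far-field axis ONLY) force `w ≡ c`: the jet cannot have a fixed integrable power-law cross-section, it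
  must SPREAD.  The far-field hypothesis cannot be dropped: columnar fields `w(x₀,x₁)` (horizontal part `∇^⊥ψ(x₀,x₁)`,
  `ψ ∈ C_c^∞`, vertical part `√(M² − |∇ψ|²)`) are genuine constant-speed divergence-free jets.
* tools: `cylRadius_add_smul_e₂`, `tendsto_add_smul_e₂_cocompact`.

WHAT THIS IS NOT: K1b is NOT proved (a spreading jet with non-integrable cross-section decay, or a flat slab, is not excluded);
nothing here proves NS regularity. [folklore]
-/

noncomputable section

open Set Filter Topology MeasureTheory Metric Function
open scoped ENNReal NNReal Topology InnerProductSpace RealInnerProductSpace ContDiff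
open Literature.Analysis.FluidPDE Literature.Analysis

namespace Summit.NavierStokesRegularity.NavierStokesRegularity.Theorems

-- the problem directory repeats the summit name (`NavierStokesRegularity/NavierStokesRegularity`)
set_option linter.dupNamespace false

namespace ExtremiserLiouville

variable {V : EuclideanSpace ℝ (Fin 3) → EuclideanSpace ℝ (Fin 3)} {c : EuclideanSpace ℝ (Fin 3)}

/-! ## Vanishing-window Liouville: a residue object whose window energies get small is trivial -/

/-- **Vanishing-window Liouville (axial far field).**  Let `V ∈ C¹` be divergence free with `⟪V, c⟫ = −‖V‖²/2`,
`c = (0,0,c₂) ≠ 0`, `‖V‖² ∈ L¹` of every slab `{|x₂| ≤ T}`, and suppose the window energies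
`E(s) = ∫ H′(x₂ − s)‖V x‖² dx` get arbitrarily small (`∀ ε > 0, ∃ s, E(s) < ε`).  Then `V ≡ 0`.  (By the energy-flux
invariance all `E(s)` coincide, hence vanish, and the windows cover `ℝ³`.)  Contrapositive = THE JET ALTERNATIVE: a non-trivial
residue object that is square integrable on slabs carries the same energy `E₀ > 0` through every unit window of planes. [folklore] -/
theorem eq_zero_of_constSpeedDeviation_smallWindow_axial (hV : ContDiff ℝ 1 V) (hdiv : VectorCalculus.IsDivFree V)
    (hVc : ∀ x, ⟪V x, c⟫ = -(‖V x‖ ^ 2 / 2)) (hc0 : c 0 = 0) (hc1 : c 1 = 0) (hc2 : c 2 ≠ 0)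
    (hslab : ∀ T : ℝ, 0 < T →
      Integrable (fun x => {x : EuclideanSpace ℝ (Fin 3) | |x 2| ≤ T}.indicator (fun x => ‖V x‖ ^ 2) x) volume)
    (hsmall : ∀ ε : ℝ, 0 < ε → ∃ s : ℝ, (∫ x, deriv Real.smoothTransition (x 2 - s) * ‖V x‖ ^ 2) < ε) :
    ∀ x, V x = 0 := by
  -- all window energies coincide
  have hconst : ∀ s t : ℝ, (∫ x, deriv Real.smoothTransition (x 2 - s) * ‖V x‖ ^ 2) =
      ∫ x, deriv Real.smoothTransition (x 2 - t) * ‖V x‖ ^ 2 := by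
    intro s t
    have hT : 0 < |s| + |t| + 1 := by positivity
    exact integral_deriv_smoothTransition_mul_sq_eq hV hdiv hVc hc0 hc1 hc2 (T := |s| + |t| + 1)
      (by linarith [abs_nonneg t]) (by linarith [abs_nonneg s]) (hslab _ hT)
  -- hence they all vanish
  have hzero : ∀ s : ℝ, (∫ x, deriv Real.smoothTransition (x 2 - s) * ‖V x‖ ^ 2) = 0 := by
    intro s
    refine le_antisymm ?_ (integral_deriv_smoothTransition_mul_sq_nonneg s)
    refine le_of_forall_pos_le_add fun ε hε => ?_
    obtain ⟨t, ht⟩ := hsmall ε hε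
    rw [hconst s t]
    linarith
  -- the window through `x` whose weight at `x` is `H′(u₀) = 1`
  obtain ⟨u₀, -, hu₀⟩ := exists_deriv_smoothTransition_eq_one
  intro x
  set s : ℝ := x 2 - u₀ with hs
  have hint := integrable_deriv_smoothTransition_mul_sq hV.continuous (T := |s| + 1) (r := s) le_rfl
    (hslab _ (by positivity))
  have hnn : ∀ y : EuclideanSpace ℝ (Fin 3), 0 ≤ deriv Real.smoothTransition (y 2 - s) * ‖V y‖ ^ 2 := fun y =>
    mul_nonneg (Real.smoothTransition.monotone.deriv_nonneg) (sq_nonneg _)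
  have hae := (integral_eq_zero_iff_of_nonneg_ae (Eventually.of_forall hnn) hint).1 (hzero s)
  have hcont : Continuous fun y : EuclideanSpace ℝ (Fin 3) => deriv Real.smoothTransition (y 2 - s) * ‖V y‖ ^ 2 :=
    ((Real.smoothTransition.contDiff.continuous_deriv le_rfl).comp
      ((PiLp.continuous_apply 2 _ (2 : Fin 3)).sub continuous_const)).mul (hV.continuous.norm.pow 2)
  have hfun := (Continuous.ae_eq_iff_eq volume hcont (continuous_const (y := (0 : ℝ)))).1 hae
  have hx : deriv Real.smoothTransition (x 2 - s) * ‖V x‖ ^ 2 = 0 := congrFun hfun x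
  have hxs : x 2 - s = u₀ := by rw [hs]; ring
  rw [hxs, hu₀, one_mul] at hx
  exact norm_eq_zero.1 (pow_eq_zero_iff two_ne_zero |>.1 hx)

/-- **Vanishing-window Liouville for constant-speed fields (axial far field).**  A `C¹` divergence-free field with
`‖w‖ ≡ M = ‖c‖`, `c = (0,0,c₂) ≠ 0`, `‖w − c‖² ∈ L¹` of every slab `{|x₂| ≤ T}` and arbitrarily small window energies
`∫ H′(x₂ − s)‖w x − c‖² dx` is the constant `c`. [folklore] -/
theorem eq_farField_of_constSpeed_of_smallWindow_axial {w : EuclideanSpace ℝ (Fin 3) → EuclideanSpace ℝ (Fin 3)}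
    (hw : ContDiff ℝ 1 w) (hdiv : VectorCalculus.IsDivFree w) {M : ℝ} (hM : ∀ x, ‖w x‖ = M) (hcM : ‖c‖ = M)
    (hc0 : c 0 = 0) (hc1 : c 1 = 0) (hc2 : c 2 ≠ 0)
    (hslab : ∀ T : ℝ, 0 < T →
      Integrable (fun x => {x : EuclideanSpace ℝ (Fin 3) | |x 2| ≤ T}.indicator (fun x => ‖w x - c‖ ^ 2) x) volume)
    (hsmall : ∀ ε : ℝ, 0 < ε → ∃ s : ℝ, (∫ x, deriv Real.smoothTransition (x 2 - s) * ‖w x - c‖ ^ 2) < ε) :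
    ∀ x, w x = c := by
  set V : EuclideanSpace ℝ (Fin 3) → EuclideanSpace ℝ (Fin 3) := fun x => w x - c with hVdef
  have hV : ContDiff ℝ 1 V := hw.sub contDiff_const
  have hVdiv : VectorCalculus.IsDivFree V := isDivFree_sub_const hdiv c
  have hVc : ∀ x, ⟪V x, c⟫ = -(‖V x‖ ^ 2 / 2) := fun x => by
    have h : ‖c + V x‖ = ‖c‖ := by simp only [hVdef, add_sub_cancel]; rw [hM x, hcM]
    exact (inner_eq_of_norm_add_eq h).1
  have h0 := eq_zero_of_constSpeedDeviation_smallWindow_axial hV hVdiv hVc hc0 hc1 hc2 hslab hsmall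
  intro x
  have := h0 x
  simpa [hVdef, sub_eq_zero] using this

/-! ## Horizontal-decay Liouville (the jet must spread): decay in the distance to the axis + far field ⇒ trivial -/

/-- The distance to the axis is invariant under axial translations. [folklore] -/
theorem cylRadius_add_smul_e₂ (x : EuclideanSpace ℝ (Fin 3)) (s : ℝ) :
    cylRadius (x + s • EuclideanSpace.single (2 : Fin 3) (1 : ℝ)) = cylRadius x := by
  simp [cylRadius]

/-- An axial translation by `s → +∞` leaves every compact set. [folklore] -/
theorem tendsto_add_smul_e₂_cocompact (y : EuclideanSpace ℝ (Fin 3)) :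
    Tendsto (fun s : ℝ => y + s • EuclideanSpace.single (2 : Fin 3) (1 : ℝ)) atTop
      (cocompact (EuclideanSpace ℝ (Fin 3))) := by
  rw [← Metric.cobounded_eq_cocompact, ← tendsto_norm_atTop_iff_cobounded]
  have hlow : ∀ s : ℝ, s - ‖y‖ ≤ ‖y + s • EuclideanSpace.single (2 : Fin 3) (1 : ℝ)‖ := fun s => by
    have h1 : ‖s • EuclideanSpace.single (2 : Fin 3) (1 : ℝ)‖ = |s| := by
      rw [norm_smul, Real.norm_eq_abs, PiLp.norm_single, norm_one, mul_one]
    have h2 := norm_sub_norm_le (s • EuclideanSpace.single (2 : Fin 3) (1 : ℝ)) (-y)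
    rw [norm_neg, sub_neg_eq_add, add_comm (s • _), h1] at h2
    linarith [le_abs_self s]
  exact tendsto_atTop_mono hlow (tendsto_atTop_add_const_right _ (-‖y‖) tendsto_id)

/-- **Horizontal-decay Liouville (axial far field).**  Let `V ∈ C¹` be divergence free with `⟪V, c⟫ = −‖V‖²/2`,
`c = (0,0,c₂) ≠ 0`, `V → 0` at infinity, and `‖V x‖ ≤ C₀ (1 + dist(x, axis))^{-a}` for some `a > 1` (decay in the distance
`cylRadius x` to the far-field axis ONLY).  Then `V ≡ 0`.  This strictly contains g4's decay-gap Liouville (`(1+‖x‖)^{-a}`);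
the far-field hypothesis cannot be dropped (columnar fields `V = V(x₀,x₁)` are genuine jets). [folklore] -/
theorem eq_zero_of_constSpeedDeviation_horizontalDecay_axial (hV : ContDiff ℝ 1 V) (hdiv : VectorCalculus.IsDivFree V)
    (hVc : ∀ x, ⟪V x, c⟫ = -(‖V x‖ ^ 2 / 2)) (hc0 : c 0 = 0) (hc1 : c 1 = 0) (hc2 : c 2 ≠ 0)
    {a C₀ : ℝ} (ha : 1 < a) (hdec : ∀ x, ‖V x‖ ≤ C₀ * (1 + cylRadius x) ^ (-a))
    (hfar : Tendsto V (cocompact (EuclideanSpace ℝ (Fin 3))) (𝓝 0)) : ∀ x, V x = 0 := by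
  set e₂ : EuclideanSpace ℝ (Fin 3) := EuclideanSpace.single (2 : Fin 3) (1 : ℝ) with he₂
  -- the squared decay bound
  have hsq : ∀ x, ‖V x‖ ^ 2 ≤ C₀ ^ 2 * (1 + cylRadius x) ^ (-(2 * a)) := fun x => by
    have hx0 : 0 ≤ 1 + cylRadius x := by have := cylRadius_nonneg x; positivity
    have hp : 0 ≤ (1 + cylRadius x) ^ (-a) := Real.rpow_nonneg hx0 _
    have e : (1 + cylRadius x) ^ (-(2 * a)) = ((1 + cylRadius x) ^ (-a)) ^ 2 := by
      rw [← Real.rpow_natCast, ← Real.rpow_mul hx0]; congr 1; push_cast; ring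
    rw [e, ← mul_pow]
    exact pow_le_pow_left₀ (norm_nonneg _) (hdec x) 2
  have hSLmeas : ∀ T : ℝ, MeasurableSet {x : EuclideanSpace ℝ (Fin 3) | |x 2| ≤ T} := fun T =>
    (isClosed_le ((continuous_apply 2 |>.comp (PiLp.continuous_ofLp 2 _)).abs) continuous_const).measurableSet
  -- slab integrability from the slab majorant
  have hslab : ∀ T : ℝ, 0 < T →
      Integrable (fun x => {x : EuclideanSpace ℝ (Fin 3) | |x 2| ≤ T}.indicator (fun x => ‖V x‖ ^ 2) x) volume := by
    intro T hT
    obtain ⟨hmaj, -⟩ := integrable_slab_cylRadius_rpow (p := 2 * a) (by linarith) (L := T) hT.le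
    refine (hmaj.const_mul (C₀ ^ 2)).mono' ?_ (Eventually.of_forall fun x => ?_)
    · exact ((hV.continuous.norm.pow 2).aestronglyMeasurable).indicator (hSLmeas T)
    · rw [Real.norm_eq_abs, abs_of_nonneg (indicator_nonneg (fun _ _ => sq_nonneg _) _)]
      by_cases hx : x ∈ {x : EuclideanSpace ℝ (Fin 3) | |x 2| ≤ T}
      · rw [indicator_of_mem hx, indicator_of_mem hx]; exact hsq x
      · rw [indicator_of_notMem hx, indicator_of_notMem hx, mul_zero]
  refine eq_zero_of_constSpeedDeviation_smallWindow_axial hV hdiv hVc hc0 hc1 hc2 hslab fun ε hε => ?_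
  -- the window energy in translated coordinates
  have htrans : ∀ s : ℝ, (∫ x, deriv Real.smoothTransition (x 2 - s) * ‖V x‖ ^ 2) =
      ∫ y, deriv Real.smoothTransition (y 2) * ‖V (y + s • e₂)‖ ^ 2 := by
    intro s
    rw [← integral_add_right_eq_self (fun x : EuclideanSpace ℝ (Fin 3) => deriv Real.smoothTransition (x 2 - s) * ‖V x‖ ^ 2) (s • e₂)]
    congr 1
    funext y
    have : (y + s • e₂) 2 - s = y 2 := by simp [he₂]
    rw [this]
  -- dominated convergence as `s → +∞`
  obtain ⟨A, hA, hHA⟩ := Literature.Analysis.Calculus.exists_bound_deriv_smoothTransition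
  obtain ⟨hmaj1, -⟩ := integrable_slab_cylRadius_rpow (p := 2 * a) (by linarith) (L := 1) zero_le_one
  have hlim : Tendsto (fun s : ℝ => ∫ y, deriv Real.smoothTransition (y 2) * ‖V (y + s • e₂)‖ ^ 2) atTop (𝓝 0) := by
    have h := tendsto_integral_filter_of_dominated_convergence
      (fun y => A * C₀ ^ 2 * {x : EuclideanSpace ℝ (Fin 3) | |x 2| ≤ 1}.indicator (fun x => (1 + cylRadius x) ^ (-(2 * a))) y)
      (F := fun (s : ℝ) (y : EuclideanSpace ℝ (Fin 3)) => deriv Real.smoothTransition (y 2) * ‖V (y + s • e₂)‖ ^ 2)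
      (f := fun _ => (0 : ℝ)) (l := atTop) (μ := volume) ?_ ?_ (hmaj1.const_mul (A * C₀ ^ 2)) ?_
    · simpa only [integral_zero] using h
    · refine Eventually.of_forall fun s => Continuous.aestronglyMeasurable ?_
      exact ((Real.smoothTransition.contDiff.continuous_deriv le_rfl).comp (PiLp.continuous_apply 2 _ (2 : Fin 3))).mul
        ((hV.continuous.comp (continuous_id.add continuous_const)).norm.pow 2)
    · refine Eventually.of_forall fun s => Eventually.of_forall fun y => ?_
      rw [Real.norm_eq_abs]
      by_cases hd : deriv Real.smoothTransition (y 2) = 0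
      · rw [hd, zero_mul, abs_zero]
        exact mul_nonneg (by positivity) (indicator_nonneg (fun z _ => Real.rpow_nonneg
          (by have := cylRadius_nonneg z; positivity) _) _)
      · obtain ⟨hl, hu⟩ := pos_and_lt_one_of_deriv_smoothTransition_ne_zero hd
        have hy : y ∈ {x : EuclideanSpace ℝ (Fin 3) | |x 2| ≤ 1} := by
          show |y 2| ≤ 1
          rw [abs_le]; constructor <;> linarith
        rw [indicator_of_mem hy, abs_mul, abs_of_nonneg (sq_nonneg ‖V (y + s • e₂)‖)]
        have h1 := hsq (y + s • e₂)
        rw [he₂, cylRadius_add_smul_e₂] at h1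
        calc |deriv Real.smoothTransition (y 2)| * ‖V (y + s • e₂)‖ ^ 2 ≤ A * (C₀ ^ 2 * (1 + cylRadius y) ^ (-(2 * a))) :=
              mul_le_mul (hHA _) (by rw [he₂]; exact h1) (sq_nonneg _) hA
          _ = A * C₀ ^ 2 * (1 + cylRadius y) ^ (-(2 * a)) := by ring
    · refine Eventually.of_forall fun y => ?_
      have hVy : Tendsto (fun s : ℝ => V (y + s • e₂)) atTop (𝓝 0) := hfar.comp (tendsto_add_smul_e₂_cocompact y)
      have h := (hVy.norm.pow 2).const_mul (deriv Real.smoothTransition (y 2))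
      rw [norm_zero, zero_pow two_ne_zero, mul_zero] at h
      exact h
  obtain ⟨s, hs⟩ := ((tendsto_order.1 hlim).2 ε hε).exists
  exact ⟨s, by rw [htrans]; exact hs⟩

/-- **Horizontal-decay Liouville for constant-speed fields (axial far field).**  A `C¹` divergence-free field with
`‖w‖ ≡ M = ‖c‖`, `c = (0,0,c₂) ≠ 0`, `w → c` at infinity and `‖w x − c‖ ≤ C₀(1 + dist(x, axis))^{-a}` (`a > 1`) is the
constant `c`: the residue object's jet cannot have an integrable power-law cross-section — it must SPREAD. [folklore] -/
theorem eq_farField_of_constSpeed_of_horizontalDecay_axial {w : EuclideanSpace ℝ (Fin 3) → EuclideanSpace ℝ (Fin 3)}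
    (hw : ContDiff ℝ 1 w) (hdiv : VectorCalculus.IsDivFree w) {M : ℝ} (hM : ∀ x, ‖w x‖ = M) (hcM : ‖c‖ = M)
    (hc0 : c 0 = 0) (hc1 : c 1 = 0) (hc2 : c 2 ≠ 0) {a C₀ : ℝ} (ha : 1 < a)
    (hdec : ∀ x, ‖w x - c‖ ≤ C₀ * (1 + cylRadius x) ^ (-a))
    (hfar : Tendsto (fun x => w x - c) (cocompact (EuclideanSpace ℝ (Fin 3))) (𝓝 0)) : ∀ x, w x = c := by
  set V : EuclideanSpace ℝ (Fin 3) → EuclideanSpace ℝ (Fin 3) := fun x => w x - c with hVdef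
  have hV : ContDiff ℝ 1 V := hw.sub contDiff_const
  have hVdiv : VectorCalculus.IsDivFree V := isDivFree_sub_const hdiv c
  have hVc : ∀ x, ⟪V x, c⟫ = -(‖V x‖ ^ 2 / 2) := fun x => by
    have h : ‖c + V x‖ = ‖c‖ := by simp only [hVdef, add_sub_cancel]; rw [hM x, hcM]
    exact (inner_eq_of_norm_add_eq h).1
  have h0 := eq_zero_of_constSpeedDeviation_horizontalDecay_axial hV hVdiv hVc hc0 hc1 hc2 ha hdec hfar
  intro x
  have := h0 x
  simpa [hVdef, sub_eq_zero] using this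

end ExtremiserLiouville

end Summit.NavierStokesRegularity.NavierStokesRegularity.Theorems

end
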